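import Summits.QuantumFields.QCD.Theses.BanksZaksTestbed
import Literature.MathematicalPhysics.QuantumFieldTheory.QCDOS

/-!
# Route `BanksZaksTestbed` (sub QCD) — support item `BanksZaksArithmetic` (stmt-QuantumFields-9565), PROVED

The Banks–Zaks arithmetic of the tree's own two-loop coefficients `b₀(N_f) = (11 − 2N_f/3)/(16π²)`,
`b₁(N_f) = (102 − 38N_f/3)/(16π²)²`, `γ₀ = 8/(16π²)`, `massExponent N_f = γ₀/(2b₀)`:
`b₀(16) > 0`, `b₁(16) < 0`, `−b₀(16)/b₁(16) = 16π²/302`, `−b₀(15)/b₁(15) = 16π²/88`, `massExponent 16 = 12`,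
`0 < b₁(N_f) ↔ N_f ≤ 8`, `0 < b₀(N_f) ↔ N_f ≤ 16` — by `norm_num`/`field_simp` and two integrality case splits.
A grounder's candidate of 2026-08-15 (g13-19, evidence on the item) exists but is not readable from a prover jail;
re-derived here.

HONEST FRAMING: arithmetic bookkeeping of a support item; the route's cruxes (`BanksZaksContinuum`, …) and the
summit conjunct `QCD` are untouched. [cite: MontvayMunster1994, §5.1 (5.66), (5.83)–(5.84); BanksZaks1982]
-/

set_option autoImplicit false

namespace Summit.QuantumFields.QCD.Theorems.BanksZaksTestbed

open Literature.MathematicalPhysics.QuantumFieldTheory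

/-- `16π² > 0`. [folklore] -/
theorem sixteen_pi_sq_pos : (0 : ℝ) < 16 * Real.pi ^ 2 := by positivity

/-- `0 < b₁(N_f) ↔ N_f ≤ 8` (no two-loop zero at or below eight flavours). [cite: MontvayMunster1994, §5.1 (5.66)] -/
theorem betaCoeff₁_pos_iff (Nf : ℕ) : 0 < betaCoeff₁ Nf ↔ Nf ≤ 8 := by
  unfold betaCoeff₁
  rw [div_pos_iff_of_pos_right (by positivity)]
  constructor
  · intro h
    by_contra hc
    have h9 : (9 : ℝ) ≤ Nf := by exact_mod_cast Nat.lt_of_not_le hc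
    linarith
  · intro h
    have h8 : (Nf : ℝ) ≤ 8 := by exact_mod_cast h
    linarith

/-- `0 < b₀(N_f) ↔ N_f ≤ 16` (the asymptotic-freedom window). [cite: MontvayMunster1994, §5.1 (5.66)] -/
theorem betaCoeff₀_pos_iff (Nf : ℕ) : 0 < betaCoeff₀ Nf ↔ Nf ≤ 16 := by
  unfold betaCoeff₀
  rw [div_pos_iff_of_pos_right sixteen_pi_sq_pos]
  constructor
  · intro h
    by_contra hc
    have h17 : (17 : ℝ) ≤ Nf := by exact_mod_cast Nat.lt_of_not_le hc
    linarith
  · intro h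
    have h16 : (Nf : ℝ) ≤ 16 := by exact_mod_cast h
    linarith

/-- The route's support item `BanksZaksArithmetic` (stmt-QuantumFields-9565) BY NAME.
[cite: MontvayMunster1994, §5.1 (5.66), (5.83)–(5.84)] -/
theorem banksZaksArithmetic_proof :
    Summit.QuantumFields.QCD.Theses.BanksZaksTestbed.BanksZaksArithmetic := by
  have hπ : (0 : ℝ) < Real.pi ^ 2 := by positivity
  have hπ' : Real.pi ^ 2 ≠ 0 := hπ.ne'
  refine ⟨?_, ?_, ?_, ?_, ?_, betaCoeff₁_pos_iff, betaCoeff₀_pos_iff⟩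
  · rw [betaCoeff₀_pos_iff]
  · unfold betaCoeff₁
    exact div_neg_of_neg_of_pos (by norm_num) (by positivity)
  · unfold betaCoeff₀ betaCoeff₁
    field_simp
    norm_num
  · unfold betaCoeff₀ betaCoeff₁
    field_simp
    norm_num
  · unfold massExponent gammaCoeff₀ betaCoeff₀
    field_simp
    norm_num

end Summit.QuantumFields.QCD.Theorems.BanksZaksTestbed
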